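import Mathlib
import Literature.Analysis.Matrix.KyFanMaximumPrinciple
import Summits.ValiantsHypothesis.ValiantsHypothesis.Theorems.LacunarySymmetroidMatrixDescartesDefiniteMomentsZonesLoop

/-!
# `MatrixDescartes` (stmt-ValiantsHypothesis-18050) — INERTIA KIT, I: Sylvester's law in family language (negative /
# positive index of a real symmetric matrix realised and bounded by explicit vector families) and PERSISTENCE of
# definite subspaces along continuous symmetric matrix families

HONEST FRAMING.  Cell `pub-symmetroid`, seat `val-sym-mdr-p2` (gen 16); helper file `--supports` the crux
`Theses.LacunarySymmetroid.MatrixDescartes`, NO closure claim.  General linear algebra / topology (any real symmetric matrix,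
any continuous symmetric family, any format) feeding the inertia law for root counts (`…InertiaWindow`) and the exact zone count
on the intrinsic hyperbolic sector (`…DefiniteMomentsZonesExact`).  Nothing here bears on the crux in its window, on
`stub_twoSided`, on `DoorA26`/`DoorA34`, registers, or `VP ≠ VNP`.

CONTENT (no definitions: the NEGATIVE INDEX of a real symmetric = hermitian matrix `A` is written
`ν(A) = card {j // hA.eigenvalues j < 0}`, the positive index `π(A) = card {j // 0 < hA.eigenvalues j}`, the corank
`card ι − rank A`).  (§1) SYLVESTER IN FAMILY LANGUAGE: `card_add_card_le` — a family `v : α → ℝ^ι` on whose non-trivial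
combinations `A` is NEGATIVE and a linearly independent family `w : β → ℝ^ι` on whose span `A` is NON-NEGATIVE force
`card α + card β ≤ card ι` (the combined family is independent); `form_eigenvectorBasis` (`(∑ cⱼbⱼ)ᵀA(∑ cⱼbⱼ) = ∑ λⱼcⱼ²`),
the four eigenvector families (`neg_eigenFamily`, `pos_eigenFamily`, `nonneg_eigenFamily`, `nonpos_eigenFamily`), the count
`negIndex_add_posIndex_add_corank` (`ν + π + corank = card ι`), and the bounds `card_le_negIndex` / `card_le_posIndex`
(a negative family has at most `ν(A)` members; eigenvector orthonormality is the tree's `KyFan.eigenvectorBasis_dotProduct`,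
and the one-family count is the family-sum form of the tree's `SylvesterInertiaCertificate.card_le_card_eigenvalues_lt` at
`θ = 0`).  (§2) PERSISTENCE `eventually_neg_family`: if `F : ℝ → Sym` is entrywise
continuous and `F(x₀)` is negative on the combinations of a finite family, so is `F(x)` for `x` near `x₀` (compact unit
sphere of coefficients + tube lemma); hence the indices are LOWER SEMICONTINUOUS (`eventually_negIndex_ge`,
`eventually_posIndex_ge`), JUMP BY AT MOST THE CORANK (`eventually_negIndex_le`: `ν(x) ≤ ν(x₀) + corank F(x₀)` near `x₀`),
and are LOCALLY CONSTANT at non-singular points (`eventually_negIndex_eq`). [folklore]; axioms standard; no definitions.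
-/

-- layout Summits/ValiantsHypothesis/ValiantsHypothesis forces the duplicated namespace component
set_option linter.dupNamespace false

namespace Summit.ValiantsHypothesis.ValiantsHypothesis.Theorems.LacunarySymmetroidMatrixDescartes

open Matrix Finset
open scoped BigOperators Topology

namespace Inertia

variable {ι : Type} [Fintype ι] [DecidableEq ι]

/-! ## §1 Sylvester's law of inertia in family language -/

omit [Fintype ι] [DecidableEq ι] in
/-- Real symmetric matrices are hermitian. [folklore] -/
theorem isHermitian_of_isSymm {A : Matrix ι ι ℝ} (hA : A.IsSymm) : A.IsHermitian := by
  unfold Matrix.IsHermitian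
  rw [Matrix.conjTranspose_eq_transpose_of_trivial]
  exact hA

omit [DecidableEq ι] in
/-- A family on whose non-trivial combinations a form is negative is linearly independent. [folklore] -/
theorem linearIndependent_of_neg {α : Type} [Fintype α] (A : Matrix ι ι ℝ) (v : α → ι → ℝ)
    (hv : ∀ c : α → ℝ, c ≠ 0 → (∑ i, c i • v i) ⬝ᵥ (A *ᵥ ∑ i, c i • v i) < 0) :
    LinearIndependent ℝ v := by
  rw [Fintype.linearIndependent_iff]
  intro c hc
  by_contra h
  push Not at h
  obtain ⟨i, hi⟩ := h
  have hc0 : c ≠ 0 := fun h0 => hi (by rw [h0]; rfl)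
  have := hv c hc0
  rw [hc, zero_dotProduct] at this
  exact lt_irrefl _ this

omit [DecidableEq ι] in
/-- **SYLVESTER IN FAMILY LANGUAGE.**  If `A` is negative on the non-trivial combinations of `v : α → ℝ^ι` and non-negative
on the span of a linearly independent `w : β → ℝ^ι`, then `card α + card β ≤ card ι`. [folklore] -/
theorem card_add_card_le {α β : Type} [Fintype α] [Fintype β] (A : Matrix ι ι ℝ) (v : α → ι → ℝ) (w : β → ι → ℝ)
    (hv : ∀ c : α → ℝ, c ≠ 0 → (∑ i, c i • v i) ⬝ᵥ (A *ᵥ ∑ i, c i • v i) < 0)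
    (hw : LinearIndependent ℝ w) (hw0 : ∀ c : β → ℝ, 0 ≤ (∑ j, c j • w j) ⬝ᵥ (A *ᵥ ∑ j, c j • w j)) :
    Fintype.card α + Fintype.card β ≤ Fintype.card ι := by
  have hvli := linearIndependent_of_neg A v hv
  have hdisj : Disjoint (Submodule.span ℝ (Set.range v)) (Submodule.span ℝ (Set.range w)) := by
    rw [Submodule.disjoint_def]
    intro x hxv hxw
    obtain ⟨c, rfl⟩ := (Submodule.mem_span_range_iff_exists_fun ℝ).1 hxv
    obtain ⟨e, he⟩ := (Submodule.mem_span_range_iff_exists_fun ℝ).1 hxw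
    by_cases hc : c = 0
    · rw [hc]; simp
    · have h1 := hv c hc
      rw [← he] at h1
      exact absurd (hw0 e) (not_le.2 h1)
  have hli : LinearIndependent ℝ (Sum.elim v w) := hvli.sum_type hw hdisj
  have h := hli.fintype_card_le_finrank
  rwa [Fintype.card_sum, Module.finrank_fintype_fun_eq_card] at h

omit [DecidableEq ι] in
/-- Mirror: positive on the combinations of `v`, non-positive on the span of an independent `w`. [folklore] -/
theorem card_add_card_le' {α β : Type} [Fintype α] [Fintype β] (A : Matrix ι ι ℝ) (v : α → ι → ℝ) (w : β → ι → ℝ)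
    (hv : ∀ c : α → ℝ, c ≠ 0 → 0 < (∑ i, c i • v i) ⬝ᵥ (A *ᵥ ∑ i, c i • v i))
    (hw : LinearIndependent ℝ w) (hw0 : ∀ c : β → ℝ, (∑ j, c j • w j) ⬝ᵥ (A *ᵥ ∑ j, c j • w j) ≤ 0) :
    Fintype.card α + Fintype.card β ≤ Fintype.card ι := by
  refine card_add_card_le (-A) v w (fun c hc => ?_) hw (fun c => ?_)
  · rw [Matrix.neg_mulVec, dotProduct_neg, neg_lt_zero]; exact hv c hc
  · rw [Matrix.neg_mulVec, dotProduct_neg, neg_nonneg]; exact hw0 c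

/-- **The form in eigen-coordinates**: `(∑ⱼ cⱼ bⱼ)ᵀ A (∑ⱼ cⱼ bⱼ) = ∑ⱼ λⱼ cⱼ²`. [folklore] -/
theorem form_eigenvectorBasis {A : Matrix ι ι ℝ} (hA : A.IsHermitian) (c : ι → ℝ) :
    (∑ j, c j • (hA.eigenvectorBasis j).ofLp) ⬝ᵥ (A *ᵥ ∑ j, c j • (hA.eigenvectorBasis j).ofLp)
      = ∑ j, hA.eigenvalues j * c j ^ 2 := by
  have hmul : A *ᵥ ∑ j, c j • (hA.eigenvectorBasis j).ofLp
      = ∑ j, (c j * hA.eigenvalues j) • (hA.eigenvectorBasis j).ofLp := by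
    rw [Matrix.mulVec_sum]
    refine Finset.sum_congr rfl fun j _ => ?_
    rw [Matrix.mulVec_smul, hA.mulVec_eigenvectorBasis j, smul_smul]
  rw [hmul, sum_dotProduct]
  refine Finset.sum_congr rfl fun i _ => ?_
  rw [smul_dotProduct, dotProduct_sum]
  simp only [dotProduct_smul, Literature.Analysis.Matrix.KyFan.eigenvectorBasis_dotProduct hA, smul_eq_mul, mul_ite,
    mul_one, mul_zero,
    Finset.sum_ite_eq, Finset.mem_univ, if_true]
  ring

/-- A sub-family of the eigenvector basis, with coefficients extended by zero. [folklore] -/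
theorem sum_subtype_eigen {A : Matrix ι ι ℝ} (hA : A.IsHermitian) (p : ι → Prop) [DecidablePred p]
    (c : {j // p j} → ℝ) :
    ∑ i : {j // p j}, c i • (hA.eigenvectorBasis i.1).ofLp
      = ∑ j, (if h : p j then c ⟨j, h⟩ else 0) • (hA.eigenvectorBasis j).ofLp := by
  classical
  rw [← Finset.sum_subset (Finset.subset_univ (Finset.univ.filter p))
    (fun j _ hj => by
      have hj' : ¬ p j := by simpa using hj
      rw [dif_neg hj', zero_smul]),
    Finset.sum_subtype (p := p) (Finset.univ.filter p) (fun j => by simp)]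
  refine Finset.sum_congr rfl fun i _ => ?_
  rw [dif_pos i.2]

/-- The form on a sub-family of the eigenvector basis: `∑_{p j} λⱼ cⱼ²`. [folklore] -/
theorem form_subtype_eigen {A : Matrix ι ι ℝ} (hA : A.IsHermitian) (p : ι → Prop) [DecidablePred p]
    (c : {j // p j} → ℝ) :
    (∑ i : {j // p j}, c i • (hA.eigenvectorBasis i.1).ofLp) ⬝ᵥ
        (A *ᵥ ∑ i : {j // p j}, c i • (hA.eigenvectorBasis i.1).ofLp)
      = ∑ i : {j // p j}, hA.eigenvalues i.1 * c i ^ 2 := by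
  classical
  rw [sum_subtype_eigen hA p c, form_eigenvectorBasis]
  rw [← Finset.sum_subset (Finset.subset_univ (Finset.univ.filter p))
    (fun j _ hj => by
      have hj' : ¬ p j := by simpa using hj
      rw [dif_neg hj']; ring),
    Finset.sum_subtype (p := p) (Finset.univ.filter p) (fun j => by simp)]
  refine Finset.sum_congr rfl fun i _ => ?_
  rw [dif_pos i.2]

/-- Sub-families of the eigenvector basis are linearly independent. [folklore] -/
theorem linearIndependent_subtype_eigen {A : Matrix ι ι ℝ} (hA : A.IsHermitian) (p : ι → Prop) :
    LinearIndependent ℝ (fun i : {j // p j} => (hA.eigenvectorBasis i.1).ofLp) := by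
  classical
  rw [Fintype.linearIndependent_iff]
  intro c hc i₀
  have h := congrArg (fun u => u ⬝ᵥ (hA.eigenvectorBasis i₀.1).ofLp) hc
  simp only [sum_dotProduct, smul_dotProduct, Literature.Analysis.Matrix.KyFan.eigenvectorBasis_dotProduct hA,
    zero_dotProduct, smul_eq_mul, mul_ite,
    mul_one, mul_zero] at h
  rw [Finset.sum_eq_single i₀ (fun i _ hi => if_neg fun h' => hi (Subtype.ext h')) (fun h' => absurd (mem_univ _) h')]
    at h
  simpa using h

/-- **Negative eigenvector family**: `A` is negative on the non-trivial combinations of its eigenvectors with negative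
eigenvalue. [folklore] -/
theorem neg_eigenFamily {A : Matrix ι ι ℝ} (hA : A.IsHermitian) (c : {j // hA.eigenvalues j < 0} → ℝ) (hc : c ≠ 0) :
    (∑ i, c i • (hA.eigenvectorBasis i.1).ofLp) ⬝ᵥ (A *ᵥ ∑ i, c i • (hA.eigenvectorBasis i.1).ofLp) < 0 := by
  classical
  rw [form_subtype_eigen hA (fun j => hA.eigenvalues j < 0) c]
  obtain ⟨i, hi⟩ : ∃ i, c i ≠ 0 := by
    by_contra h; push Not at h; exact hc (funext h)
  calc ∑ i : {j // hA.eigenvalues j < 0}, hA.eigenvalues i.1 * c i ^ 2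
      < ∑ _i : {j // hA.eigenvalues j < 0}, (0 : ℝ) :=
        Finset.sum_lt_sum (fun k _ => mul_nonpos_of_nonpos_of_nonneg k.2.le (sq_nonneg _))
          ⟨i, mem_univ _, mul_neg_of_neg_of_pos i.2 (by positivity)⟩
    _ = 0 := Finset.sum_const_zero

/-- **Positive eigenvector family.** [folklore] -/
theorem pos_eigenFamily {A : Matrix ι ι ℝ} (hA : A.IsHermitian) (c : {j // 0 < hA.eigenvalues j} → ℝ) (hc : c ≠ 0) :
    0 < (∑ i, c i • (hA.eigenvectorBasis i.1).ofLp) ⬝ᵥ (A *ᵥ ∑ i, c i • (hA.eigenvectorBasis i.1).ofLp) := by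
  classical
  rw [form_subtype_eigen hA (fun j => 0 < hA.eigenvalues j) c]
  obtain ⟨i, hi⟩ : ∃ i, c i ≠ 0 := by
    by_contra h; push Not at h; exact hc (funext h)
  calc (0 : ℝ) = ∑ _i : {j // 0 < hA.eigenvalues j}, (0 : ℝ) := Finset.sum_const_zero.symm
    _ < ∑ i : {j // 0 < hA.eigenvalues j}, hA.eigenvalues i.1 * c i ^ 2 :=
        Finset.sum_lt_sum (fun k _ => mul_nonneg k.2.le (sq_nonneg _))
          ⟨i, mem_univ _, mul_pos i.2 (by positivity)⟩

/-- **Non-negative eigenvector family** (eigenvalues `≥ 0`). [folklore] -/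
theorem nonneg_eigenFamily {A : Matrix ι ι ℝ} (hA : A.IsHermitian) (c : {j // 0 ≤ hA.eigenvalues j} → ℝ) :
    0 ≤ (∑ i, c i • (hA.eigenvectorBasis i.1).ofLp) ⬝ᵥ (A *ᵥ ∑ i, c i • (hA.eigenvectorBasis i.1).ofLp) := by
  classical
  rw [form_subtype_eigen hA (fun j => 0 ≤ hA.eigenvalues j) c]
  exact Finset.sum_nonneg fun k _ => mul_nonneg k.2 (sq_nonneg _)

/-- **Non-positive eigenvector family** (eigenvalues `≤ 0`). [folklore] -/
theorem nonpos_eigenFamily {A : Matrix ι ι ℝ} (hA : A.IsHermitian) (c : {j // hA.eigenvalues j ≤ 0} → ℝ) :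
    (∑ i, c i • (hA.eigenvectorBasis i.1).ofLp) ⬝ᵥ (A *ᵥ ∑ i, c i • (hA.eigenvectorBasis i.1).ofLp) ≤ 0 := by
  classical
  rw [form_subtype_eigen hA (fun j => hA.eigenvalues j ≤ 0) c]
  exact Finset.sum_nonpos fun k _ => mul_nonpos_of_nonpos_of_nonneg k.2 (sq_nonneg _)

/-- **Index count**: `ν(A) + π(A) + corank A = card ι`. [folklore] -/
theorem negIndex_add_posIndex_add_corank {A : Matrix ι ι ℝ} (hA : A.IsHermitian) :
    Fintype.card {j // hA.eigenvalues j < 0} + Fintype.card {j // 0 < hA.eigenvalues j}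
      + (Fintype.card ι - A.rank) = Fintype.card ι ∧ A.rank ≤ Fintype.card ι := by
  classical
  have hrank := hA.rank_eq_card_non_zero_eigs
  have h1 : Fintype.card {j // hA.eigenvalues j ≠ 0}
      = Fintype.card {j // hA.eigenvalues j < 0} + Fintype.card {j // 0 < hA.eigenvalues j} := by
    rw [Fintype.card_subtype, Fintype.card_subtype, Fintype.card_subtype]
    rw [← Finset.card_union_of_disjoint]
    · congr 1
      ext j
      simp only [Finset.mem_filter, Finset.mem_univ, true_and, Finset.mem_union]
      exact ⟨fun h => lt_or_gt_of_ne h, fun h => h.elim ne_of_lt ne_of_gt⟩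
    · rw [Finset.disjoint_filter]
      intro j _ h1 h2
      exact lt_asymm h1 h2
  have h2 : Fintype.card {j // hA.eigenvalues j ≠ 0} ≤ Fintype.card ι := Fintype.card_subtype_le _
  refine ⟨?_, by rw [hrank]; exact h2⟩
  rw [hrank, ← h1]
  omega

/-- Complement count: `card {0 ≤ λ} = card ι − ν(A)`. [folklore] -/
theorem card_nonneg_eigs {A : Matrix ι ι ℝ} (hA : A.IsHermitian) :
    Fintype.card {j // 0 ≤ hA.eigenvalues j} = Fintype.card ι - Fintype.card {j // hA.eigenvalues j < 0} := by
  classical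
  have h : (fun j => 0 ≤ hA.eigenvalues j) = fun j => ¬ (hA.eigenvalues j < 0) := by
    funext j; exact propext not_lt.symm
  simp only [h]
  exact Fintype.card_subtype_compl _

/-- Complement count: `card {λ ≤ 0} = card ι − π(A)`. [folklore] -/
theorem card_nonpos_eigs {A : Matrix ι ι ℝ} (hA : A.IsHermitian) :
    Fintype.card {j // hA.eigenvalues j ≤ 0} = Fintype.card ι - Fintype.card {j // 0 < hA.eigenvalues j} := by
  classical
  have h : (fun j => hA.eigenvalues j ≤ 0) = fun j => ¬ (0 < hA.eigenvalues j) := by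
    funext j; exact propext not_lt.symm
  simp only [h]
  exact Fintype.card_subtype_compl _

omit [DecidableEq ι] in
/-- **A negative family has at most `ν(A)` members.** [folklore] -/
theorem card_le_negIndex [DecidableEq ι] {α : Type} [Fintype α] {A : Matrix ι ι ℝ} (hA : A.IsHermitian)
    (v : α → ι → ℝ) (hv : ∀ c : α → ℝ, c ≠ 0 → (∑ i, c i • v i) ⬝ᵥ (A *ᵥ ∑ i, c i • v i) < 0) :
    Fintype.card α ≤ Fintype.card {j // hA.eigenvalues j < 0} := by
  have h := card_add_card_le A v _ hv (linearIndependent_subtype_eigen hA fun j => 0 ≤ hA.eigenvalues j)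
    (nonneg_eigenFamily hA)
  rw [card_nonneg_eigs hA] at h
  have := Fintype.card_subtype_le fun j => hA.eigenvalues j < 0
  omega

omit [DecidableEq ι] in
/-- **A positive family has at most `π(A)` members.** [folklore] -/
theorem card_le_posIndex [DecidableEq ι] {α : Type} [Fintype α] {A : Matrix ι ι ℝ} (hA : A.IsHermitian)
    (v : α → ι → ℝ) (hv : ∀ c : α → ℝ, c ≠ 0 → 0 < (∑ i, c i • v i) ⬝ᵥ (A *ᵥ ∑ i, c i • v i)) :
    Fintype.card α ≤ Fintype.card {j // 0 < hA.eigenvalues j} := by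
  have h := card_add_card_le' A v _ hv (linearIndependent_subtype_eigen hA fun j => hA.eigenvalues j ≤ 0)
    (nonpos_eigenFamily hA)
  rw [card_nonpos_eigs hA] at h
  have := Fintype.card_subtype_le fun j => 0 < hA.eigenvalues j
  omega

/-! ## §2 Persistence of definite families along continuous symmetric matrix families -/

omit [Fintype ι] [DecidableEq ι] in
/-- Homogeneity of the combination. [folklore] -/
theorem sum_smul_smul {α : Type} [Fintype α] (v : α → ι → ℝ) (t : ℝ) (c : α → ℝ) :
    ∑ i, (t • c) i • v i = t • ∑ i, c i • v i := by
  rw [Finset.smul_sum]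
  exact Finset.sum_congr rfl fun i _ => by rw [Pi.smul_apply, smul_eq_mul, mul_smul]

omit [DecidableEq ι] in
/-- Joint continuity of `(x, c) ↦ (∑ cᵢvᵢ)ᵀ F(x) (∑ cᵢvᵢ)` for an entrywise continuous family `F`. [folklore] -/
theorem continuous_form_family {α : Type} [Fintype α] (F : ℝ → Matrix ι ι ℝ) (hF : ∀ i j, Continuous fun x => F x i j)
    (v : α → ι → ℝ) :
    Continuous fun p : ℝ × (α → ℝ) => (∑ i, p.2 i • v i) ⬝ᵥ (F p.1 *ᵥ ∑ i, p.2 i • v i) := by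
  have hcomb : ∀ a : ι, Continuous fun p : ℝ × (α → ℝ) => (∑ i, p.2 i • v i) a := by
    intro a
    have h : (fun p : ℝ × (α → ℝ) => (∑ i, p.2 i • v i) a) = fun p => ∑ i, p.2 i * v i a := by
      funext p; simp [Finset.sum_apply, Pi.smul_apply, smul_eq_mul]
    rw [h]
    exact continuous_finsetSum _ fun i _ => ((continuous_apply i).comp continuous_snd).mul continuous_const
  unfold dotProduct Matrix.mulVec
  refine continuous_finsetSum _ fun a _ => (hcomb a).mul ?_
  exact continuous_finsetSum _ fun b _ => ((hF a b).comp continuous_fst).mul (hcomb b)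

omit [DecidableEq ι] in
/-- Homogeneity of the form in the coefficients: degree two. [folklore] -/
theorem form_comb_smul {α : Type} [Fintype α] (A : Matrix ι ι ℝ) (v : α → ι → ℝ) (t : ℝ) (c : α → ℝ) :
    (∑ i, (t • c) i • v i) ⬝ᵥ (A *ᵥ ∑ i, (t • c) i • v i)
      = t * t * ((∑ i, c i • v i) ⬝ᵥ (A *ᵥ ∑ i, c i • v i)) := by
  rw [sum_smul_smul, Matrix.mulVec_smul, smul_dotProduct, dotProduct_smul, smul_eq_mul, smul_eq_mul, mul_assoc]

omit [DecidableEq ι] in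
/-- **PERSISTENCE.**  If `F(x₀)` is negative on the non-trivial combinations of a finite family `v`, then so is `F(x)` for
all `x` near `x₀` (`F` entrywise continuous). [folklore] -/
theorem eventually_neg_family {α : Type} [Fintype α] (F : ℝ → Matrix ι ι ℝ) (hF : ∀ i j, Continuous fun x => F x i j)
    (v : α → ι → ℝ) (x₀ : ℝ) (hv : ∀ c : α → ℝ, c ≠ 0 → (∑ i, c i • v i) ⬝ᵥ (F x₀ *ᵥ ∑ i, c i • v i) < 0) :
    ∀ᶠ x in 𝓝 x₀, ∀ c : α → ℝ, c ≠ 0 → (∑ i, c i • v i) ⬝ᵥ (F x *ᵥ ∑ i, c i • v i) < 0 := by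
  have hQc := continuous_form_family F hF v
  have hK : IsCompact (Metric.sphere (0 : α → ℝ) 1) := isCompact_sphere _ _
  have hP : ∀ c ∈ Metric.sphere (0 : α → ℝ) 1, ∀ᶠ z : ℝ × (α → ℝ) in 𝓝 (x₀, c),
      (∑ i, z.2 i • v i) ⬝ᵥ (F z.1 *ᵥ ∑ i, z.2 i • v i) < 0 := by
    intro c hc
    have hc0 : c ≠ 0 := by
      intro h; rw [h] at hc; simp at hc
    exact hQc.continuousAt.eventually_lt continuousAt_const (hv c hc0)
  have h := hK.eventually_forall_of_forall_eventually
    (P := fun x y => (∑ i, y i • v i) ⬝ᵥ (F x *ᵥ ∑ i, y i • v i) < 0) hP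
  refine h.mono fun x hx c hc0 => ?_
  have hnorm : 0 < ‖c‖ := norm_pos_iff.2 hc0
  have hc₁mem : ‖c‖⁻¹ • c ∈ Metric.sphere (0 : α → ℝ) 1 := by
    rw [mem_sphere_zero_iff_norm, norm_smul, norm_inv, norm_norm, inv_mul_cancel₀ hnorm.ne']
  have hx₁ := hx _ hc₁mem
  have hcc : c = ‖c‖ • (‖c‖⁻¹ • c) := by rw [smul_smul, mul_inv_cancel₀ hnorm.ne', one_smul]
  rw [hcc, form_comb_smul]
  exact mul_neg_of_pos_of_neg (mul_pos hnorm hnorm) hx₁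

omit [DecidableEq ι] in
/-- **PERSISTENCE, positive form.** [folklore] -/
theorem eventually_pos_family {α : Type} [Fintype α] (F : ℝ → Matrix ι ι ℝ) (hF : ∀ i j, Continuous fun x => F x i j)
    (v : α → ι → ℝ) (x₀ : ℝ) (hv : ∀ c : α → ℝ, c ≠ 0 → 0 < (∑ i, c i • v i) ⬝ᵥ (F x₀ *ᵥ ∑ i, c i • v i)) :
    ∀ᶠ x in 𝓝 x₀, ∀ c : α → ℝ, c ≠ 0 → 0 < (∑ i, c i • v i) ⬝ᵥ (F x *ᵥ ∑ i, c i • v i) := by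
  have h := eventually_neg_family (fun x => -F x) (fun i j => (hF i j).neg) v x₀ (fun c hc => by
    rw [Matrix.neg_mulVec, dotProduct_neg, neg_lt_zero]; exact hv c hc)
  refine h.mono fun x hx c hc => ?_
  have := hx c hc
  rwa [Matrix.neg_mulVec, dotProduct_neg, neg_lt_zero] at this

/-! ## §3 Semicontinuity and jumps of the indices -/

/-- **Lower semicontinuity of the negative index.** [folklore] -/
theorem eventually_negIndex_ge (F : ℝ → Matrix ι ι ℝ) (hF : ∀ i j, Continuous fun x => F x i j)
    (hH : ∀ x, (F x).IsHermitian) (x₀ : ℝ) :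
    ∀ᶠ x in 𝓝 x₀, Fintype.card {j // (hH x₀).eigenvalues j < 0} ≤ Fintype.card {j // (hH x).eigenvalues j < 0} := by
  have h := eventually_neg_family F hF (fun i : {j // (hH x₀).eigenvalues j < 0} => ((hH x₀).eigenvectorBasis i.1).ofLp)
    x₀ (neg_eigenFamily (hH x₀))
  exact h.mono fun x hx => card_le_negIndex (hH x) _ hx

/-- **Lower semicontinuity of the positive index.** [folklore] -/
theorem eventually_posIndex_ge (F : ℝ → Matrix ι ι ℝ) (hF : ∀ i j, Continuous fun x => F x i j)
    (hH : ∀ x, (F x).IsHermitian) (x₀ : ℝ) :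
    ∀ᶠ x in 𝓝 x₀, Fintype.card {j // 0 < (hH x₀).eigenvalues j} ≤ Fintype.card {j // 0 < (hH x).eigenvalues j} := by
  have h := eventually_pos_family F hF (fun i : {j // 0 < (hH x₀).eigenvalues j} => ((hH x₀).eigenvectorBasis i.1).ofLp)
    x₀ (pos_eigenFamily (hH x₀))
  exact h.mono fun x hx => card_le_posIndex (hH x) _ hx

/-- **Jump bound**: near `x₀` the negative index exceeds `ν(F(x₀))` by at most `corank F(x₀)`. [folklore] -/
theorem eventually_negIndex_le (F : ℝ → Matrix ι ι ℝ) (hF : ∀ i j, Continuous fun x => F x i j)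
    (hH : ∀ x, (F x).IsHermitian) (x₀ : ℝ) :
    ∀ᶠ x in 𝓝 x₀, Fintype.card {j // (hH x).eigenvalues j < 0}
      ≤ Fintype.card {j // (hH x₀).eigenvalues j < 0} + (Fintype.card ι - (F x₀).rank) := by
  refine (eventually_posIndex_ge F hF hH x₀).mono fun x hx => ?_
  have h0 := negIndex_add_posIndex_add_corank (hH x₀)
  have h1 := negIndex_add_posIndex_add_corank (hH x)
  omega

/-- Mirror jump bound for the positive index. [folklore] -/
theorem eventually_posIndex_le (F : ℝ → Matrix ι ι ℝ) (hF : ∀ i j, Continuous fun x => F x i j)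
    (hH : ∀ x, (F x).IsHermitian) (x₀ : ℝ) :
    ∀ᶠ x in 𝓝 x₀, Fintype.card {j // 0 < (hH x).eigenvalues j}
      ≤ Fintype.card {j // 0 < (hH x₀).eigenvalues j} + (Fintype.card ι - (F x₀).rank) := by
  refine (eventually_negIndex_ge F hF hH x₀).mono fun x hx => ?_
  have h0 := negIndex_add_posIndex_add_corank (hH x₀)
  have h1 := negIndex_add_posIndex_add_corank (hH x)
  omega

/-- Non-singular matrices have corank zero. [folklore] -/
theorem corank_eq_zero_of_det_ne_zero {A : Matrix ι ι ℝ} (hA : A.det ≠ 0) : Fintype.card ι - A.rank = 0 := by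
  rw [Matrix.rank_of_isUnit A ((Matrix.isUnit_iff_isUnit_det A).2 (isUnit_iff_ne_zero.2 hA))]
  omega

/-- **Local constancy at non-singular points.** [folklore] -/
theorem eventually_negIndex_eq (F : ℝ → Matrix ι ι ℝ) (hF : ∀ i j, Continuous fun x => F x i j)
    (hH : ∀ x, (F x).IsHermitian) (x₀ : ℝ) (hx₀ : (F x₀).det ≠ 0) :
    ∀ᶠ x in 𝓝 x₀, Fintype.card {j // (hH x).eigenvalues j < 0} = Fintype.card {j // (hH x₀).eigenvalues j < 0} := by
  refine ((eventually_negIndex_ge F hF hH x₀).and (eventually_negIndex_le F hF hH x₀)).mono fun x hx => ?_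
  rw [corank_eq_zero_of_det_ne_zero hx₀] at hx
  omega

end Inertia

end Summit.ValiantsHypothesis.ValiantsHypothesis.Theorems.LacunarySymmetroidMatrixDescartes
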